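import Summits.QuantumFields.YangMills.Theorems.ConvexGribovBodyNonSimplyConnectedLatticeGapWeakMixingFunnel
import HarnessLib

/-!
# Coarse scales suffice for weak mixing on cubes
# (stub `stub_boxInfluenceDecay_of_progression` (P) of crux stmt-QuantumFields-16405, route `ConvexGribovBody`,
# line `Sketch` v6)

For the lattice Yang–Mills specification `γ = ymSpecification ρ β` on `ℤ⁴` and a gauge-invariant local observable `A`:
if the boundary influence `|γ_{Λ_{bk}}(A | η) − γ_{Λ_{bk}}(A | η')|` on the cubes of links `Λ_{bk} = [−bk, bk]⁴ × univ`
decays like `C e^{−mk}` along the progression of radii `b·k`, then on EVERY cube `Λ_L` it is at most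
`C e^{m} e^{−(m/b)L}`. Proof: with `k := L / b` one has `bk ≤ L < b(k+1)`, so `Λ_{bk} ⊆ Λ_L` and the influence on
`Λ_L` is at most the influence on `Λ_{bk}` (antitonicity of the influence in the volume = consistency of the
specification, the landed stub `stub_influence_antitone`, Georgii 2011 Def. 1.23 (iii)), which is
`≤ C e^{−mk} ≤ C e^{m − (m/b)L}`.
-/

set_option autoImplicit false

noncomputable section

open MeasureTheory
open Literature.Probability.LatticeModels
open Literature.MathematicalPhysics.QuantumLattice
open Literature.MathematicalPhysics.QuantumFieldTheory (isSpecification_ymSpecification_of_t2Space)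

namespace Summit.QuantumFields.YangMills.Theorems.NonSimplyConnectedLatticeGap

/-- **Coarse scales suffice** (registered stub `stub_boxInfluenceDecay_of_progression` (P) of the skeleton
`Cruxes/NonSimplyConnectedLatticeGap/Lines/Sketch.lean` v6 of item stmt-QuantumFields-16405): exponential decay of the
cube influence of a gauge-invariant local observable along the cubes of radius `b·k` (rate `m` in `k`, constant `C`)
gives decay on all cubes of radius `L` at rate `m / b` with constant `C e^{m}`, by antitonicity of the influence in
the volume (`stub_influence_antitone`) applied to `Λ_{b (L/b)} ⊆ Λ_L`. -/
theorem stub_boxInfluenceDecay_of_progression : ∀ (G : Type) [Group G] [TopologicalSpace G] [IsTopologicalGroup G] [CompactSpace G] [MeasurableSpace G] [BorelSpace G] [SecondCountableTopology G] [T2Space G] (N : ℕ) (ρ : G →* Matrix (Fin N) (Fin N) ℂ), Continuous ρ → ∀ (β : ℝ) (b : ℕ), 1 ≤ b → ∀ (m : ℝ), 0 ≤ m → ∀ (A : Literature.MathematicalPhysics.QuantumLattice.LocalGaugeObservable 4 G) (C : ℝ), (∀ (k : ℕ) (η η' : Literature.MathematicalPhysics.QuantumLattice.LGConfig 4 G),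 |(∫ U, A.F U ∂(Literature.MathematicalPhysics.QuantumLattice.ymSpecification ρ β ((Fintype.piFinset fun _ : Fin 4 => Finset.Icc (-((b * k : ℕ) : ℤ)) ((b * k : ℕ) : ℤ)) ×ˢ (Finset.univ : Finset (Fin 4))) η)) - ∫ U, A.F U ∂(Literature.MathematicalPhysics.QuantumLattice.ymSpecification ρ β ((Fintype.piFinset fun _ : Fin 4 => Finset.Icc (-((b * k : ℕ) : ℤ)) ((b * k : ℕ) : ℤ)) ×ˢ (Finset.univ : Finset (Fin 4))) η')| ≤ C * Real.exp (-(m * k))) → ∀ (L : ℕ) (η η' : Literature.MathematicalPhysics.QuantumLattice.LGConfig 4 G), |(∫ U, A.F U ∂(Literature.MathematicalPhysics.QuantumLattice.ymSpecification ρ β ((Fintype.piFinset fun _ : Fin 4 => Finset.Icc (-((L : ℕ) : ℤ)) ((L : ℕ) : ℤ)) ×ˢ (Finset.univ : Finset (Fin 4))) η)) - ∫ U, A.F U ∂(Literature.MathematicalPhysics.QuantumLattice.ymSpecification ρ β ((Fintype.piFinset fun _ : Fin 4 => Finset.Icc (-((L : ℕ) : ℤ)) ((L : ℕ) : ℤ))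 ×ˢ (Finset.univ : Finset (Fin 4))) η')| ≤ C * Real.exp m * Real.exp (-(m / b * L)) := by
  intro G _ _ _ _ _ _ _ _ N ρ hρ β b hb m hm A C hdec L η η'
  obtain ⟨B, hB⟩ := A.bounded
  -- `C ≥ 0`, from the hypothesis at `k = 0`, `η = η'`
  have hC0 : 0 ≤ C := by
    have h1 : (0 : ℝ) ≤ C * Real.exp (-(m * ((0 : ℕ) : ℝ))) := (abs_nonneg _).trans (hdec 0 η η)
    simpa using h1
  -- the coarse scale `k = L / b`: `b k ≤ L < b (k + 1)`
  obtain ⟨k, hk⟩ : ∃ k : ℕ, k = L / b := ⟨_, rfl⟩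
  have hb0 : 0 < b := hb
  have hkL : b * k ≤ L := by rw [hk]; exact Nat.mul_div_le L b
  have hLk : L < b * (k + 1) := by rw [hk]; exact Nat.lt_mul_div_succ L hb0
  -- the cube of radius `b k` sits inside the cube of radius `L`
  have hsub : (Fintype.piFinset fun _ : Fin 4 => Finset.Icc (-((b * k : ℕ) : ℤ)) ((b * k : ℕ) : ℤ)) ×ˢ
      (Finset.univ : Finset (Fin 4)) ⊆
      (Fintype.piFinset fun _ : Fin 4 => Finset.Icc (-((L : ℕ) : ℤ)) ((L : ℕ) : ℤ)) ×ˢ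
      (Finset.univ : Finset (Fin 4)) := by
    refine Finset.product_subset_product_left (Fintype.piFinset_subset _ _ fun _ => ?_)
    have h : ((b * k : ℕ) : ℤ) ≤ ((L : ℕ) : ℤ) := by exact_mod_cast hkL
    exact Finset.Icc_subset_Icc (neg_le_neg h) h
  -- antitonicity of the influence in the volume (consistency of the YM specification)
  have hγ := isSpecification_ymSpecification_of_t2Space (d := 4) ρ hρ β
  have hanti := stub_influence_antitone _ G (ymSpecification ρ β) hγ _ _ hsub A.F A.measurable B hB
    (C * Real.exp (-(m * k))) (hdec k) η η'
  refine hanti.trans ?_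
  -- `C e^{-m k} ≤ C e^{m} e^{-(m/b) L}` since `L < b (k + 1)`
  rw [mul_assoc, ← Real.exp_add]
  refine mul_le_mul_of_nonneg_left (Real.exp_le_exp.2 ?_) hC0
  have hbr : (0 : ℝ) < b := by exact_mod_cast hb0
  have hL' : (L : ℝ) ≤ b * (k + 1) := by exact_mod_cast hLk.le
  have h1 : m / b * L ≤ m / b * (b * (k + 1)) := mul_le_mul_of_nonneg_left hL' (div_nonneg hm hbr.le)
  have h2 : m / b * (b * ((k : ℝ) + 1)) = m * (k + 1) := by
    field_simp
  rw [h2] at h1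
  linarith only [h1]

end Summit.QuantumFields.YangMills.Theorems.NonSimplyConnectedLatticeGap

end
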